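import Summits.QuantumFields.YangMills.Theorems.UnitScaleTiltProp7Lane2PlateauCutoff
import Summits.QuantumFields.YangMills.Theorems.UnitScaleTiltProp7Lane2SupportInChart
import Summits.QuantumFields.YangMills.Theorems.UnitScaleTiltProp7SectET3HilbertLettersT3
import Summits.QuantumFields.YangMills.Theorems.UnitScaleTiltProp7SPrintDefs
import Summits.QuantumFields.YangMills.Theorems.UnitScaleTiltProp8ChartHInvGeometry
import HarnessLib

/-!
# Route `UnitScaleTilt`, crux K1 «MinimiserStabilityRegPr» (stmt-QuantumFields-19200), LANE II «DIVERGENCE RECOVERY AT CURVED `W`» (★★OWNER RULING №23), [I-9] text of record (P2)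
# «PEEL, DON'T RE-ANCHOR» (★p1 g19 NAMER WORD №16, 2026-08-29): **THE BOX-PLATEAU CUTOFF `χ_g` OF A PATCH** — a third cutoff per patch, equal to `1` on every fine site whose
# torus block is within coarse distance `2L^s − 1` of the patch block, vanishing two layers inside the chart box, with steps `≤ 2∕ℓ` — and its multiplication operators

Cell `ym3-torus` (HUMAN RULING D-0037, YM ladder rung R3 — YM₃ on T³ is a rung, NOT d = 4, NOT infinite volume, NOT a mass gap, NOT Clay; YM gap NOT proved), width seat
`ym-ust-19200-w1` (gen 16).  THEOREMS ONLY (0 `def`, 0 `sorry`); `--supports stmt-QuantumFields-19200 --as helper`; count-neutral.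

WHY.  In the [I-9] knit of `hPatch` (✓`Prop7DivRecoveryPatchesToRows.hRows_of_core_and_patches`) the coarse-gradient row h9 is ✓`Prop7QkcInnerPatchRows.coarseGrad_rows_on_inner`,
which needs, for every coarse bond `ĉ` in the PEELED index set of h7∕h8 (coarse bonds with both endpoints in the chart box's blocks `[lo+4, lo+m−4]³`), a cutoff that is `1`
on every fine site whose torus block is within cyclic sup-distance `2` of `ĉ₋` and whose bond multiplier satisfies the local equation `Zχb (D_Wφ) = Zχb y − Zχb r` — i.e. a
cutoff supported on INSIDE-chart bonds (✓`Prop7DivRecoveryCutoffReadings.patch_hDφ`).  (B6)'s `ζ_g` (support radius `L^s·ℓ`) and the plateau cutoff `ζ̃_g` (plateau `L^s + 2`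
blocks) are too small; this file supplies the third cutoff `χ_g` with plateau `2L^s·ℓ − 1` around the patch's centre corner and ramp `(3ℓ − 5)∕2` — still two layers inside the
record box `box z_c (R_f − 2)`, so w5-20520's ✓`cutoffH1_member` reads `H(Zχb r)` with `δ = 2∕ℓ`.

WHAT IS PROVED (sorry-free, no definition; `ℓ = L^{K−n}`, `R₀ = L^s`, `dist(a,b) = min (a−b).val (b−a).val`; the cutoff is packaged by `∃`, its rows displayed):
* §1 ★★★`exists_boxPlateauCutoff (c : Site (F.P K) 0)` — `∃ χ Zχs Zχb`: values in `[0,1]`; PLATEAU `(∀ κ, dist(x κ, c κ) ≤ 2R₀ℓ − 1) → χ x = 1`; SUPPORT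
  `χ x ≠ 0 → ∀ κ, dist(x κ, c κ) < 2R₀ℓ − 1 + (3ℓ−5)∕2`; STEPS `|χ(x ± e_μ) − χ x| ≤ 2∕ℓ`; the (Z2) readings `toL2S⁻¹(Zχs φ) x = χ x • toL2S⁻¹ φ x`,
  `toL2⁻¹(Zχb f) b = χ b.src • toL2⁻¹ f b` (px11's shape VERBATIM).
* §2 ★★`boxPlateau_eq_one_of_block_near` — at a block CORNER centre `c κ = (C κ).val·ℓ`: `(∀ κ, dist((iterBlockOf (K−n) x) κ, C κ) ≤ 2R₀ − 1) → χ x = 1` (px9 ✓`dist_le_of_iterBlockOf`);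
  ★`boxPlateau_eq_one_on_readSet` — the `hS` row of ✓`coarseGrad_rows_on_inner` for the peeled set: `dist(ĉ₋, C) ≤ 2R₀ − 3` and blocks within `2` of `ĉ₋`.
* §3 the BASE CHART (`c₀ = basePt`, px9 ✓`Prop7Lane2SupportInChart` §3 letters: `w₀ = val c − val c₀`, `z_c = ℓ·(w₀∕ℓ) + (ℓ−1)∕2`, `R_f = (2R₀+1)ℓ + (ℓ−1)∕2`) at a CORNER centre:
  ★`cornerChart_centre` (`z_c = w₀ − 1`), ★★`exists_mem_box_of_boxPlateau_ne_zero` (`χ x ≠ 0 → ∃ w ∈ box z_c (R_f − 2), transl basePt w = x`), ★`boxPlateau_eq_zero_off_box`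
  (✓`cutoffH1_member`'s `hζs` at `R_f − 1`), ★`exists_mem_box_bond_of_boxPlateau_ne_zero` (✓`patch_hDφ`'s `hξ`).
HONEST SCOPE.  Clamp ∕ cyclic-distance ∕ residue bookkeeping over px9's letters; nothing of the lattice gauge theory, of (B7)∕`hPatch`∕(REC)∕hN06∕EX∕the crux is claimed.

References: T. Bałaban, CMP **99** (1985) 389–434 [Balaban1985BackgroundPropagators] ((3.100) pp.413–414: cutoffs at scale `M` and their commutators; (3.23) p.394);
CMP **96** (1984) 223–250 [Balaban1984PropagatorsII] (p.238: smooth lattice cutoffs); [folklore].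
-/

set_option autoImplicit false

noncomputable section

open scoped BigOperators

namespace Summit.QuantumFields.YangMills.Theorems.Prop7Lane2BoxPlateauCutoff

open Literature.MathematicalPhysics.QuantumFieldTheory.Balaban1983to89
open Literature.MathematicalPhysics.QuantumFieldTheory.Balaban1983to89.T3ContinuumYM3Torus
open Literature.MathematicalPhysics.QuantumFieldTheory.Balaban1983to89.B4Eq19LatticeOperators (Zd box unitVec mem_box box_mono add_unitVec_mem_box)
open B5Eq118OneStroke (iterBlockOf)
open B11Eq103H1Complex (SiteL2K BondL2K)
open B10Eq27TorusAxialLog (transl transl_apply)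
open B15DeterminingSets (embIter)
open Summit.QuantumFields.YangMills.Theorems.Prop7SectET3Transport (periodsT3)
open Summit.QuantumFields.YangMills.Theorems.Prop7SectET3HilbertLetters (W₂ toL2 toL2S)
open Summit.QuantumFields.YangMills.Theorems.Prop7SPrint (basePt)
open Summit.QuantumFields.YangMills.Theorems.Prop7Lane2PlateauCutoff (cycDist_triangle plateauHat_mem plateauHat_eq_one lt_of_plateauHat_ne_zero abs_plateauHat_sub_le
  val_corner dist_le_of_iterBlockOf)
open Summit.QuantumFields.YangMills.Theorems.Prop7Lane2CyclicHats (dist_add_one_le dist_sub_one_le)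
open Summit.QuantumFields.YangMills.Theorems.Prop7Lane2SupportInChart (transl_valSub_eq exists_mem_box_transl_eq_recentre)

variable (F : T3Family) (n K s : ℕ) {c₀ : ℝ}

/-! ## §1 The box-plateau cutoff at an arbitrary centre: values, plateau, support, steps, and the two multiplication operators -/

/-- Positivity of the ramp `T = (3ℓ − 5)∕2` (`ℓ = L^{K−n} ≥ 3`: `L` is odd and `> 1`, `n < K`). [folklore] -/
theorem boxRamp_pos (hnK : n < K) : 0 < ((3 * (F.L : ℝ) ^ (K - n) - 5) / 2) := by
  have hL3 : 3 ≤ F.L := by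
    obtain ⟨r, hr⟩ := F.hL.1
    have := F.hL.2
    omega
  have hℓ3 : (3 : ℝ) ≤ (F.L : ℝ) ^ (K - n) := by
    have h1 : (3 : ℝ) ≤ F.L := by exact_mod_cast hL3
    calc (3 : ℝ) = 3 ^ 1 := by norm_num
      _ ≤ (F.L : ℝ) ^ 1 := by gcongr
      _ ≤ (F.L : ℝ) ^ (K - n) := pow_le_pow_right₀ (by linarith) (by omega)
  linarith

/-- `1∕T ≤ 2∕ℓ` for the ramp `T = (3ℓ − 5)∕2`, `ℓ ≥ 3`. [folklore] -/
theorem inv_boxRamp_le (hnK : n < K) : 1 / ((3 * (F.L : ℝ) ^ (K - n) - 5) / 2) ≤ 2 / (F.L : ℝ) ^ (K - n) := by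
  have hL3 : 3 ≤ F.L := by
    obtain ⟨r, hr⟩ := F.hL.1
    have := F.hL.2
    omega
  have hℓ3 : (3 : ℝ) ≤ (F.L : ℝ) ^ (K - n) := by
    have h1 : (3 : ℝ) ≤ F.L := by exact_mod_cast hL3
    calc (3 : ℝ) = 3 ^ 1 := by norm_num
      _ ≤ (F.L : ℝ) ^ 1 := by gcongr
      _ ≤ (F.L : ℝ) ^ (K - n) := pow_le_pow_right₀ (by linarith) (by omega)
  rw [div_le_div_iff₀ (by linarith) (by linarith)]
  linarith

/-- ★★★ **THE BOX-PLATEAU CUTOFF PACKAGE AT A CENTRE `c`**: there are a cutoff `χ : Site → ℝ` and its two multiplication operators `Zχs` (site fields), `Zχb` (one-forms, weight at the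
source) with: values in `[0,1]`; PLATEAU — `χ x = 1` whenever every coordinate of `x` is within cyclic distance `2L^s·ℓ − 1` of `c`; SUPPORT — `χ x ≠ 0` forces every coordinate
within cyclic distance `< 2L^sℓ − 1 + (3ℓ−5)∕2`; STEPS — `|χ(x ± e_μ) − χ x| ≤ 2∕ℓ`; and the (Z2) readings.  (Witness: `χ x = Π_κ h(dist(x κ, c κ))`, `h(d) = max 0 (min 1 ((P+T−d)∕T))`,
`P = 2L^sℓ − 1`, `T = (3ℓ−5)∕2`; the operators conjugate the scalar multiplication through `toL2S`∕`toL2`.) [cite: Balaban1985BackgroundPropagators, (3.100) pp.413-414] -/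
theorem exists_boxPlateauCutoff (hnK : n < K) (c : Site (F.P K) 0) :
    ∃ (χ : Site (F.P K) 0 → ℝ)
      (Zχs : SiteL2K ℂ 3 (periodsT3 F K) c₀ W₂ →ₗ[ℂ] SiteL2K ℂ 3 (periodsT3 F K) c₀ W₂)
      (Zχb : BondL2K ℂ 3 (periodsT3 F K) c₀ W₂ →ₗ[ℂ] BondL2K ℂ 3 (periodsT3 F K) c₀ W₂),
      (∀ x, 0 ≤ χ x ∧ χ x ≤ 1) ∧
      (∀ x, (∀ κ : Fin 3, ((min (x κ - c κ).val (c κ - x κ).val : ℕ) : ℝ) ≤ 2 * (F.L : ℝ) ^ s * (F.L : ℝ) ^ (K - n) - 1) → χ x = 1) ∧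
      (∀ x, χ x ≠ 0 → ∀ κ : Fin 3, ((min (x κ - c κ).val (c κ - x κ).val : ℕ) : ℝ)
          < (2 * (F.L : ℝ) ^ s * (F.L : ℝ) ^ (K - n) - 1) + (3 * (F.L : ℝ) ^ (K - n) - 5) / 2) ∧
      (∀ x (μ : Fin 3), |χ (x.shift μ) - χ x| ≤ 2 / (F.L : ℝ) ^ (K - n) ∧ |χ (x.unshift μ) - χ x| ≤ 2 / (F.L : ℝ) ^ (K - n)) ∧
      (∀ φ x, (toL2S F K c₀).symm (Zχs φ) x = χ x • (toL2S F K c₀).symm φ x) ∧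
      (∀ f b, (toL2 F K c₀).symm (Zχb f) b = χ b.src • (toL2 F K c₀).symm f b) := by
  have hN : 1 < (F.P K).sitesPerDir 0 :=
    (by show 1 < 2 * F.L ^ (F.m + K - 0); have := Nat.one_le_pow (F.m + K - 0) F.L (by have := F.hL.2; omega); omega)
  have hT := boxRamp_pos F n K hnK
  -- letters
  set P : ℝ := 2 * (F.L : ℝ) ^ s * (F.L : ℝ) ^ (K - n) - 1 with hP
  set T : ℝ := (3 * (F.L : ℝ) ^ (K - n) - 5) / 2 with hTdef
  let χ : Site (F.P K) 0 → ℝ := fun x => ∏ κ : Fin 3, max 0 (min 1 ((P + T - ((min (x κ - c κ).val (c κ - x κ).val : ℕ) : ℝ)) / T))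
  -- the multiplication maps on the functions, conjugated through the Hilbert transports
  let mS : (Site (F.P K) 0 → Matrix (Fin 2) (Fin 2) ℂ) →ₗ[ℂ] (Site (F.P K) 0 → Matrix (Fin 2) (Fin 2) ℂ) :=
    { toFun := fun g x => ((χ x : ℝ) : ℂ) • g x
      map_add' := fun g g' => by funext x; simp only [Pi.add_apply, smul_add]
      map_smul' := fun r g => by funext x; simp only [Pi.smul_apply, RingHom.id_apply, smul_comm r] }
  let mB : (PBond (F.P K) 0 → Matrix (Fin 2) (Fin 2) ℂ) →ₗ[ℂ] (PBond (F.P K) 0 → Matrix (Fin 2) (Fin 2) ℂ) :=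
    { toFun := fun g b => ((χ b.src : ℝ) : ℂ) • g b
      map_add' := fun g g' => by funext b; simp only [Pi.add_apply, smul_add]
      map_smul' := fun r g => by funext b; simp only [Pi.smul_apply, RingHom.id_apply, smul_comm r] }
  refine ⟨χ, (toL2S F K c₀).toLinearMap ∘ₗ mS ∘ₗ (toL2S F K c₀).symm.toLinearMap,
    (toL2 F K c₀).toLinearMap ∘ₗ mB ∘ₗ (toL2 F K c₀).symm.toLinearMap, ?_, ?_, ?_, ?_, ?_, ?_⟩
  · -- values in `[0,1]`
    intro x
    exact ⟨Finset.prod_nonneg fun _ _ => (plateauHat_mem _).1,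
      Finset.prod_le_one (fun _ _ => (plateauHat_mem _).1) fun _ _ => (plateauHat_mem _).2⟩
  · -- plateau
    intro x hx
    exact Finset.prod_eq_one fun κ _ => plateauHat_eq_one hT (hx κ)
  · -- support
    intro x hx κ
    exact lt_of_plateauHat_ne_zero hT (Finset.prod_ne_zero_iff.mp hx κ (Finset.mem_univ κ))
  · -- steps: replacing the `μ`-th factor of a product of `[0,1]`-numbers moves it by at most the move of that factor
    intro x μ
    have hinv := inv_boxRamp_le F n K hnK
    have key : ∀ y : Site (F.P K) 0, (∀ κ, κ ≠ μ → y κ = x κ) →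
        (((min (y μ - c μ).val (c μ - y μ).val : ℕ) : ℝ) ≤ (min (x μ - c μ).val (c μ - x μ).val : ℕ) + 1) →
        (((min (x μ - c μ).val (c μ - x μ).val : ℕ) : ℝ) ≤ (min (y μ - c μ).val (c μ - y μ).val : ℕ) + 1) →
        |χ y - χ x| ≤ 2 / (F.L : ℝ) ^ (K - n) := by
      intro y hy h1 h2
      show |(∏ κ : Fin 3, max 0 (min 1 ((P + T - ((min (y κ - c κ).val (c κ - y κ).val : ℕ) : ℝ)) / T)))
          - ∏ κ : Fin 3, max 0 (min 1 ((P + T - ((min (x κ - c κ).val (c κ - x κ).val : ℕ) : ℝ)) / T))| ≤ _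
      rw [← Finset.prod_erase_mul _ _ (Finset.mem_univ μ), ← Finset.prod_erase_mul _ _ (Finset.mem_univ μ)]
      have hrest : ∏ κ ∈ Finset.univ.erase μ, max 0 (min 1 ((P + T - ((min (y κ - c κ).val (c κ - y κ).val : ℕ) : ℝ)) / T))
          = ∏ κ ∈ Finset.univ.erase μ, max 0 (min 1 ((P + T - ((min (x κ - c κ).val (c κ - x κ).val : ℕ) : ℝ)) / T)) :=
        Finset.prod_congr rfl fun κ hκ => by rw [hy κ (Finset.ne_of_mem_erase hκ)]
      rw [hrest, ← mul_sub, abs_mul]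
      have hP0 : 0 ≤ ∏ κ ∈ Finset.univ.erase μ, max 0 (min 1 ((P + T - ((min (x κ - c κ).val (c κ - x κ).val : ℕ) : ℝ)) / T)) :=
        Finset.prod_nonneg fun κ _ => (plateauHat_mem _).1
      have hP1 : ∏ κ ∈ Finset.univ.erase μ, max 0 (min 1 ((P + T - ((min (x κ - c κ).val (c κ - x κ).val : ℕ) : ℝ)) / T)) ≤ 1 :=
        Finset.prod_le_one (fun κ _ => (plateauHat_mem _).1) fun κ _ => (plateauHat_mem _).2
      have hfac := abs_plateauHat_sub_le (P := P) hT ((min (x μ - c μ).val (c μ - x μ).val : ℕ) : ℝ) ((min (y μ - c μ).val (c μ - y μ).val : ℕ) : ℝ)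
      have hd : |(((min (y μ - c μ).val (c μ - y μ).val : ℕ) : ℝ)) - ((min (x μ - c μ).val (c μ - x μ).val : ℕ) : ℝ)| ≤ 1 :=
        abs_sub_le_iff.mpr ⟨by linarith, by linarith⟩
      rw [abs_of_nonneg hP0]
      calc (∏ κ ∈ Finset.univ.erase μ, max 0 (min 1 ((P + T - ((min (x κ - c κ).val (c κ - x κ).val : ℕ) : ℝ)) / T)))
            * |max 0 (min 1 ((P + T - ((min (y μ - c μ).val (c μ - y μ).val : ℕ) : ℝ)) / T))
                - max 0 (min 1 ((P + T - ((min (x μ - c μ).val (c μ - x μ).val : ℕ) : ℝ)) / T))|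
          ≤ 1 * (1 / T) := mul_le_mul hP1 (hfac.trans (div_le_div_of_nonneg_right hd hT.le)) (abs_nonneg _) zero_le_one
        _ ≤ 2 / (F.L : ℝ) ^ (K - n) := by rw [one_mul]; exact hinv
    constructor
    · refine key (x.shift μ) (fun κ hκ => show Function.update x μ (x μ + 1) κ = x κ from Function.update_of_ne hκ _ _) ?_ ?_
      · have h := (dist_add_one_le hN (x μ) (c μ)).1
        have e : x.shift μ μ = x μ + 1 := by simp [Site.shift]
        rw [e]; exact_mod_cast h
      · have h := (dist_add_one_le hN (x μ) (c μ)).2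
        have e : x.shift μ μ = x μ + 1 := by simp [Site.shift]
        rw [e]; exact_mod_cast h
    · refine key (x.unshift μ) (fun κ hκ => show Function.update x μ (x μ - 1) κ = x κ from Function.update_of_ne hκ _ _) ?_ ?_
      · have h := (dist_sub_one_le hN (x μ) (c μ)).1
        have e : x.unshift μ μ = x μ - 1 := by simp [Site.unshift]
        rw [e]; exact_mod_cast h
      · have h := (dist_sub_one_le hN (x μ) (c μ)).2
        have e : x.unshift μ μ = x μ - 1 := by simp [Site.unshift]
        rw [e]; exact_mod_cast h
  · -- (Z2) site reading
    intro φ x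
    show (toL2S F K c₀).symm (toL2S F K c₀ (mS ((toL2S F K c₀).symm φ))) x = _
    rw [LinearEquiv.symm_apply_apply]
    exact Complex.coe_smul _ _
  · -- (Z2) bond reading
    intro f b
    show (toL2 F K c₀).symm (toL2 F K c₀ (mB ((toL2 F K c₀).symm f))) b = _
    rw [LinearEquiv.symm_apply_apply]
    exact Complex.coe_smul _ _

/-! ## §2 A letter of the base chart (the other, `transl c₀ (val c − val c₀) = c`, is px9 ✓`Prop7Lane2SupportInChart.transl_valSub_eq`) -/

/-- The base point's labels: `val (basePt κ) = (ℓ − 1)∕2` (`basePt = embIter (K−n) 0`, B12's centred labelling). [cite: Balaban1987RG1, (0.1) p.252] -/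
theorem val_basePt (κ : Fin (F.P K).d) : ((basePt F n K) κ).val = (F.L ^ (K - n) - 1) / 2 := by
  have hk : K - n ≤ (F.P K).m + (F.P K).K := by show K - n ≤ F.m + K; omega
  have h := ChartHInv.val_embIter (P := F.P K) (K - n) hk (0 : Site (F.P K) (K - n)) κ
  rw [show ((0 : Site (F.P K) (K - n)) κ) = 0 from rfl, ZMod.val_zero, zero_mul, zero_add] at h
  exact h

/-! ## §3 At a block-corner centre: torus-block plateau, and the base-chart support rows -/

section Corner

variable (C : Site (F.P K) (K - n)) (c : Site (F.P K) 0)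
  (hc : ∀ κ : Fin 3, c κ = (((C κ).val * F.L ^ (K - n) : ℕ) : ZMod ((F.P K).sitesPerDir 0)))
include hc

/-- ★★ **TORUS-BLOCK PLATEAU**: for a cutoff with the §1 plateau row around the CORNER site `c κ = (C κ).val·ℓ` of a coarse site `C`, every fine site whose `(K−n)`-block is within
coarse cyclic sup-distance `2L^s − 1` of `C` has `χ x = 1` (px9 ✓`dist_le_of_iterBlockOf`: `dist(x_κ, c_κ) ≤ ℓ·dist(Y_κ, C_κ) + (ℓ − 1)`).
[cite: Balaban1985BackgroundPropagators, (3.100) p.413; Balaban1984PropagatorsI, (1.6) p.18] -/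
theorem boxPlateau_eq_one_of_block_near (hnK : n ≤ K) (χ : Site (F.P K) 0 → ℝ)
    (hplat : ∀ x : Site (F.P K) 0, (∀ κ : Fin 3, ((min (x κ - c κ).val (c κ - x κ).val : ℕ) : ℝ) ≤ 2 * (F.L : ℝ) ^ s * (F.L : ℝ) ^ (K - n) - 1) → χ x = 1)
    (x : Site (F.P K) 0)
    (hY : ∀ κ : Fin 3, min ((iterBlockOf (K - n) x) κ - C κ).val (C κ - (iterBlockOf (K - n) x) κ).val ≤ 2 * F.L ^ s - 1) :
    χ x = 1 := by
  refine hplat x fun κ => ?_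
  rw [hc κ]
  have h1 := dist_le_of_iterBlockOf F n K hnK C x κ
  have h2 := hY κ
  have hL : 1 ≤ F.L := by have := F.hL.2; omega
  have hR1 : 1 ≤ F.L ^ s := Nat.one_le_pow _ _ hL
  have hℓ1 : 1 ≤ F.L ^ (K - n) := Nat.one_le_pow _ _ hL
  have h2A : 1 ≤ 2 * F.L ^ s := by omega
  have h5 := Nat.mul_le_mul_left (F.L ^ (K - n)) h2
  have h3 : ((min (x κ - (((C κ).val * F.L ^ (K - n) : ℕ) : ZMod ((F.P K).sitesPerDir 0))).val
        ((((C κ).val * F.L ^ (K - n) : ℕ) : ZMod ((F.P K).sitesPerDir 0)) - x κ).val : ℕ) : ℝ) + 1 ≤ 2 * (F.L : ℝ) ^ s * (F.L : ℝ) ^ (K - n) := by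
    zify [h2A, hℓ1] at h1 h5
    have h6 : ((min (x κ - (((C κ).val * F.L ^ (K - n) : ℕ) : ZMod ((F.P K).sitesPerDir 0))).val
        ((((C κ).val * F.L ^ (K - n) : ℕ) : ZMod ((F.P K).sitesPerDir 0)) - x κ).val : ℕ) : ℤ) + 1 ≤ 2 * (F.L : ℤ) ^ s * (F.L : ℤ) ^ (K - n) := by
      push_cast at h1 h5 ⊢
      nlinarith
    exact_mod_cast h6
  linarith

/-- ★ **THE `hS` ROW OF ✓`coarseGrad_rows_on_inner` ON THE PEELED SET**: if the coarse bond's source `ĉ₋` satisfies `dist(ĉ₋, C) + 3 ≤ 2L^s` coordinatewise, then every fine site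
whose `(K−n)`-block is within `2` of `ĉ₋` has `χ x = 1` (triangle inequality + the torus-block plateau). [cite: Balaban1985BackgroundPropagators, (3.100) p.413] -/
theorem boxPlateau_eq_one_on_readSet (hnK : n ≤ K) (χ : Site (F.P K) 0 → ℝ)
    (hplat : ∀ x : Site (F.P K) 0, (∀ κ : Fin 3, ((min (x κ - c κ).val (c κ - x κ).val : ℕ) : ℝ) ≤ 2 * (F.L : ℝ) ^ s * (F.L : ℝ) ^ (K - n) - 1) → χ x = 1)
    (chat : PBond (F.P K) (K - n)) (hch : ∀ κ : Fin 3, min (chat.src κ - C κ).val (C κ - chat.src κ).val + 3 ≤ 2 * F.L ^ s)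
    (x : Site (F.P K) 0)
    (hx : ∀ κ : Fin (F.P K).d, min ((iterBlockOf (K - n) x) κ - chat.src κ).val (chat.src κ - (iterBlockOf (K - n) x) κ).val ≤ 2) :
    χ x = 1 := by
  refine boxPlateau_eq_one_of_block_near F n K s C c hc hnK χ hplat x fun κ => ?_
  have h1 := cycDist_triangle ((iterBlockOf (K - n) x) κ) (chat.src κ) (C κ)
  have h2 := hch κ
  have h3 := hx κ
  omega

/-- ★ **THE CORNER CHART CENTRE**: for the corner site `c κ = (C κ).val·ℓ`, the block-tiled box centre of px9's base chart is one site below it: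
`ℓ·((val c − val basePt)∕ℓ) + (ℓ−1)∕2 = (val c − val basePt) − 1` (since `val basePt = (ℓ−1)∕2`, `val c = (C κ).val·ℓ`, `ℓ` odd). [folklore] -/
theorem cornerChart_centre (hnK : n < K) (κ : Fin 3) :
    ((F.L ^ (K - n) : ℕ) : ℤ) * (((((c κ).val : ℕ) : ℤ) - ((((basePt F n K) κ).val : ℕ) : ℤ)) / ((F.L ^ (K - n) : ℕ) : ℤ)) + (((F.L ^ (K - n) : ℕ) : ℤ) - 1) / 2
      = ((((c κ).val : ℕ) : ℤ) - ((((basePt F n K) κ).val : ℕ) : ℤ)) - 1 := by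
  rw [hc κ, val_corner F n K hnK.le C κ, val_basePt F n K κ]
  obtain ⟨k, hk⟩ : Odd (F.L ^ (K - n)) := F.hL.1.pow
  have hL3 : 3 ≤ F.L := by
    obtain ⟨r, hr⟩ := F.hL.1
    have := F.hL.2
    omega
  have hℓ3 : 3 ≤ F.L ^ (K - n) := by
    calc 3 ≤ F.L := hL3
      _ = F.L ^ 1 := (pow_one _).symm
      _ ≤ F.L ^ (K - n) := Nat.pow_le_pow_right (by omega) (by omega)
  have hk1 : 1 ≤ k := by omega
  have hdiv2 : (F.L ^ (K - n) - 1) / 2 = k := by omega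
  rw [hdiv2]
  have hℓZ : ((F.L ^ (K - n) : ℕ) : ℤ) = 2 * (k : ℤ) + 1 := by exact_mod_cast hk
  have hℓZ' : (F.L : ℤ) ^ (K - n) = 2 * (k : ℤ) + 1 := by exact_mod_cast hk
  have e1 : ((((C κ).val * F.L ^ (K - n) : ℕ) : ℤ)) = ((C κ).val : ℤ) * (2 * (k : ℤ) + 1) := by push_cast; rw [hℓZ']
  rw [e1, hℓZ]
  -- `(C(2k+1) − k) / (2k+1) = C − 1` with remainder `k + 1 ∈ [0, 2k+1)`
  have hq : (((C κ).val : ℤ) * (2 * (k : ℤ) + 1) - (k : ℤ)) / (2 * (k : ℤ) + 1) = ((C κ).val : ℤ) - 1 := by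
    have e2 : ((C κ).val : ℤ) * (2 * (k : ℤ) + 1) - (k : ℤ) = ((k : ℤ) + 1) + (2 * (k : ℤ) + 1) * (((C κ).val : ℤ) - 1) := by ring
    rw [e2, Int.add_mul_ediv_left _ _ (by omega : (2 * (k : ℤ) + 1) ≠ 0), Int.ediv_eq_zero_of_lt (by omega) (by omega), zero_add]
  rw [hq]
  have e3 : ((2 * (k : ℤ) + 1) - 1) / 2 = k := by omega
  rw [e3]
  ring

/-- ★★ **THE SUPPORT OF `χ` IN THE BASE CHART**: at the corner centre `c`, a site with every coordinate within cyclic distance `< 2L^sℓ − 1 + (3ℓ−5)∕2` of `c` (the §1 support row) is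
`transl basePt w` for some `w ∈ box z_c (R_f − 2)` — two layers inside the record chart box of the patch (`z_c`, `R_f` in px9 ✓`Prop7Lane2SupportInChart` §3's letters with
`c₀ := basePt`). [cite: Balaban1985BackgroundPropagators, (3.100) p.413] -/
theorem exists_mem_box_of_dist_lt_corner (hnK : n < K) (x : Site (F.P K) 0)
    (hx : ∀ κ : Fin 3, ((min (x κ - c κ).val (c κ - x κ).val : ℕ) : ℝ) < (2 * (F.L : ℝ) ^ s * (F.L : ℝ) ^ (K - n) - 1) + (3 * (F.L : ℝ) ^ (K - n) - 5) / 2) :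
    ∃ w ∈ box (fun κ : Fin (F.P K).d => ((F.L ^ (K - n) : ℕ) : ℤ) *
          (((((c κ).val : ℕ) : ℤ) - ((((basePt F n K) κ).val : ℕ) : ℤ)) / ((F.L ^ (K - n) : ℕ) : ℤ)) + (((F.L ^ (K - n) : ℕ) : ℤ) - 1) / 2)
        ((2 * ((F.L ^ s : ℕ) : ℤ) + 1) * ((F.L ^ (K - n) : ℕ) : ℤ) + (((F.L ^ (K - n) : ℕ) : ℤ) - 1) / 2 - 2),
      transl (basePt F n K) w = x := by
  obtain ⟨k, hk⟩ : Odd (F.L ^ (K - n)) := F.hL.1.pow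
  have hL : 1 ≤ F.L := by have := F.hL.2; omega
  have hL3 : 3 ≤ F.L := by
    obtain ⟨r, hr⟩ := F.hL.1
    have := F.hL.2
    omega
  have hℓ3 : 3 ≤ F.L ^ (K - n) := by
    calc 3 ≤ F.L := hL3
      _ = F.L ^ 1 := (pow_one _).symm
      _ ≤ F.L ^ (K - n) := Nat.pow_le_pow_right (by omega) (by omega)
  have hR1 : 1 ≤ F.L ^ s := Nat.one_le_pow _ _ hL
  have hk1 : 1 ≤ k := by omega
  -- the support radius as a natural number: `D = 2L^sℓ − 1 + (3ℓ − 5)/2 = 2L^sℓ + 3k − 2`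
  have h2 : 2 ≤ 2 * F.L ^ s * F.L ^ (K - n) + 3 * k := by nlinarith
  have hD : (2 * (F.L : ℝ) ^ s * (F.L : ℝ) ^ (K - n) - 1) + (3 * (F.L : ℝ) ^ (K - n) - 5) / 2 = ((2 * F.L ^ s * F.L ^ (K - n) + 3 * k - 2 : ℕ) : ℝ) := by
    rw [Nat.cast_sub h2]
    push_cast
    have : ((F.L : ℝ) ^ (K - n)) = 2 * (k : ℝ) + 1 := by exact_mod_cast hk
    rw [this]; ring
  have hx' : ∀ κ : Fin 3, min (x κ - c κ).val (c κ - x κ).val < 2 * F.L ^ s * F.L ^ (K - n) + 3 * k - 2 := by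
    intro κ
    have h := hx κ
    rw [hD] at h
    exact_mod_cast h
  -- the margins of the re-centred generic row at `z := −1`, `R := R_f − 2`
  have hℓZ : ((F.L ^ (K - n) : ℕ) : ℤ) = 2 * (k : ℤ) + 1 := by exact_mod_cast hk
  have hℓZ' : (F.L : ℤ) ^ (K - n) = 2 * (k : ℤ) + 1 := by exact_mod_cast hk
  have eD : ((2 * F.L ^ s * F.L ^ (K - n) + 3 * k - 2 : ℕ) : ℤ) = 2 * ((F.L ^ s : ℕ) : ℤ) * (2 * (k : ℤ) + 1) + 3 * (k : ℤ) - 2 := by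
    rw [Nat.cast_sub h2]; push_cast; rw [hℓZ']
  have e3 : ((2 * (k : ℤ) + 1) - 1) / 2 = k := by omega
  have hR1' : (1 : ℤ) ≤ ((F.L ^ s : ℕ) : ℤ) := by exact_mod_cast hR1
  have hlo : ∀ κ : Fin (F.P K).d, (fun _ : Fin (F.P K).d => (-1 : ℤ)) κ
      - ((2 * ((F.L ^ s : ℕ) : ℤ) + 1) * ((F.L ^ (K - n) : ℕ) : ℤ) + (((F.L ^ (K - n) : ℕ) : ℤ) - 1) / 2 - 2)
        ≤ 1 - ((2 * F.L ^ s * F.L ^ (K - n) + 3 * k - 2 : ℕ) : ℤ) := by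
    intro κ
    rw [eD, hℓZ, e3]
    dsimp only
    nlinarith
  have hhi : ∀ κ : Fin (F.P K).d, ((2 * F.L ^ s * F.L ^ (K - n) + 3 * k - 2 : ℕ) : ℤ) - 1
      ≤ (fun _ : Fin (F.P K).d => (-1 : ℤ)) κ
        + ((2 * ((F.L ^ s : ℕ) : ℤ) + 1) * ((F.L ^ (K - n) : ℕ) : ℤ) + (((F.L ^ (K - n) : ℕ) : ℤ) - 1) / 2 - 2) := by
    intro κ
    rw [eD, hℓZ, e3]
    dsimp only
    nlinarith
  obtain ⟨w, hw, he⟩ := exists_mem_box_transl_eq_recentre F K (basePt F n K) c x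
    (fun κ => (((c κ).val : ℕ) : ℤ) - ((((basePt F n K) κ).val : ℕ) : ℤ))
    (transl_valSub_eq F K (basePt F n K) c) (fun _ => -1)
    ((2 * ((F.L ^ s : ℕ) : ℤ) + 1) * ((F.L ^ (K - n) : ℕ) : ℤ) + (((F.L ^ (K - n) : ℕ) : ℤ) - 1) / 2 - 2)
    (2 * F.L ^ s * F.L ^ (K - n) + 3 * k - 2) hlo hhi hx'
  refine ⟨w, ?_, he⟩
  have e : ((fun κ => (((c κ).val : ℕ) : ℤ) - ((((basePt F n K) κ).val : ℕ) : ℤ)) + fun _ : Fin (F.P K).d => (-1 : ℤ))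
      = fun κ : Fin (F.P K).d => ((F.L ^ (K - n) : ℕ) : ℤ) *
          (((((c κ).val : ℕ) : ℤ) - ((((basePt F n K) κ).val : ℕ) : ℤ)) / ((F.L ^ (K - n) : ℕ) : ℤ)) + (((F.L ^ (K - n) : ℕ) : ℤ) - 1) / 2 := by
    funext κ
    rw [Pi.add_apply, cornerChart_centre F n K C c hc hnK κ]
    ring
  rw [e] at hw
  exact hw

/-- ★ **THE `hζs` ROW OF ✓`cutoffH1_member` FOR `χ`** (at `R := R_f`): a site that is NOT a chart point of `box z_c (R_f − 1)` has `χ x = 0` (support ⊆ image of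
`box z_c (R_f − 2) ⊆ box z_c (R_f − 1)`). [cite: Balaban1985BackgroundPropagators, (3.100) p.413] -/
theorem boxPlateau_eq_zero_off_box (hnK : n < K) (χ : Site (F.P K) 0 → ℝ)
    (hsupp : ∀ x : Site (F.P K) 0, χ x ≠ 0 → ∀ κ : Fin 3, ((min (x κ - c κ).val (c κ - x κ).val : ℕ) : ℝ)
        < (2 * (F.L : ℝ) ^ s * (F.L : ℝ) ^ (K - n) - 1) + (3 * (F.L : ℝ) ^ (K - n) - 5) / 2)
    (x : Site (F.P K) 0)
    (hx : ∀ w ∈ box (fun κ : Fin (F.P K).d => ((F.L ^ (K - n) : ℕ) : ℤ) *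
          (((((c κ).val : ℕ) : ℤ) - ((((basePt F n K) κ).val : ℕ) : ℤ)) / ((F.L ^ (K - n) : ℕ) : ℤ)) + (((F.L ^ (K - n) : ℕ) : ℤ) - 1) / 2)
        ((2 * ((F.L ^ s : ℕ) : ℤ) + 1) * ((F.L ^ (K - n) : ℕ) : ℤ) + (((F.L ^ (K - n) : ℕ) : ℤ) - 1) / 2 - 1),
      transl (basePt F n K) w ≠ x) :
    χ x = 0 := by
  by_contra h
  obtain ⟨w, hw, he⟩ := exists_mem_box_of_dist_lt_corner F n K s C c hc hnK x (hsupp x h)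
  exact hx w (box_mono _ (by omega) hw) he

/-- ★ **THE `hξ` ROW OF ✓`patch_hDφ` FOR `Zχb`**: a bond whose source carries `χ ≠ 0` is an INSIDE-chart bond of the record box `box z_c R_f` (source in `box z_c (R_f − 2)`, target one
layer further). [cite: Balaban1985BackgroundPropagators, (3.100) p.413] -/
theorem exists_mem_box_bond_of_boxPlateau_ne_zero (hnK : n < K) (χ : Site (F.P K) 0 → ℝ)
    (hsupp : ∀ x : Site (F.P K) 0, χ x ≠ 0 → ∀ κ : Fin 3, ((min (x κ - c κ).val (c κ - x κ).val : ℕ) : ℝ)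
        < (2 * (F.L : ℝ) ^ s * (F.L : ℝ) ^ (K - n) - 1) + (3 * (F.L : ℝ) ^ (K - n) - 5) / 2)
    (b : PBond (F.P K) 0) (hb : χ b.src ≠ 0) :
    ∃ w ∈ box (fun κ : Fin (F.P K).d => ((F.L ^ (K - n) : ℕ) : ℤ) *
          (((((c κ).val : ℕ) : ℤ) - ((((basePt F n K) κ).val : ℕ) : ℤ)) / ((F.L ^ (K - n) : ℕ) : ℤ)) + (((F.L ^ (K - n) : ℕ) : ℤ) - 1) / 2)
        ((2 * ((F.L ^ s : ℕ) : ℤ) + 1) * ((F.L ^ (K - n) : ℕ) : ℤ) + (((F.L ^ (K - n) : ℕ) : ℤ) - 1) / 2),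
      transl (basePt F n K) w = b.src ∧
      w + unitVec b.dir ∈ box (fun κ : Fin (F.P K).d => ((F.L ^ (K - n) : ℕ) : ℤ) *
          (((((c κ).val : ℕ) : ℤ) - ((((basePt F n K) κ).val : ℕ) : ℤ)) / ((F.L ^ (K - n) : ℕ) : ℤ)) + (((F.L ^ (K - n) : ℕ) : ℤ) - 1) / 2)
        ((2 * ((F.L ^ s : ℕ) : ℤ) + 1) * ((F.L ^ (K - n) : ℕ) : ℤ) + (((F.L ^ (K - n) : ℕ) : ℤ) - 1) / 2) := by
  obtain ⟨w, hw, he⟩ := exists_mem_box_of_dist_lt_corner F n K s C c hc hnK b.src (hsupp b.src hb)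
  exact ⟨w, box_mono _ (by omega) hw, he, box_mono _ (by omega) (add_unitVec_mem_box hw b.dir)⟩

end Corner

end Summit.QuantumFields.YangMills.Theorems.Prop7Lane2BoxPlateauCutoff

end
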